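import Literature.Analysis.Calculus.AlternatingDivisionThree -- ★ LH10-p02 (g9): `exists_contDiff_symm_vandermonde_smul_of_alternating` (alternating = Δ • symmetric), `vandermonde3_comp_swap ∕ _comp_perm`; brings ★ `HadamardDivisionLast` (`lastQuot`, `eq_smul_lastQuot`, `contDiff_lastQuot`)
import Literature.Analysis.Calculus.GlaeserSymmetricThree    -- ★ p851824 `exists_contDiff_comp_esymm_three_of_forall_perm` (Glaeser–Chevalley for `S₃`); brings ★ `SymmetricGermCutoff` (`exists_contDiff_prod_cutoff`, `contDiff_smul_fst_of_tsupport_subset`)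
import Mathlib.Analysis.SpecificLimits.Basic
import HarnessLib

/-!
# «Hadamard ×3», riders: Hadamard division by a linear functional, density of the regular set, the TRANSPOSITION form and the GERM form of «anti-invariant = Vandermonde ×
# invariant», uniqueness of the quotient, and the composition with Glaeser–Chevalley (over ★ `AlternatingDivisionThree`; Hörmander ALPDO I Thm. 1.1.9; Bourbaki LIE VIII §8)

Topic `Analysis/Calculus`; namespace `Literature.Analysis.Calculus`.  THEOREMS ONLY (no `def`, no instance, no notation, no axiom, no named fact, no `sorry`); Mathlib + ★
`HadamardDivisionLast`.  Cell `pub/hodgecm-mathlib`, crux H413 (`stmt-HodgeConjecture-24833`), line LH2 (closer stub `stub_N8`), N8-INNER ROAD B «EP road» (dealer LH2-plan (g1),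
16:17:17Z GO): riders of the brick **«HADAMARD ×3»** of the corner package (C′) ∕ junction census (c-ii) — «the `stableSumG` germ at a scalar corner is smooth and `S₃`-ANTI-invariant in the
three angles, hence `Δ · (S₃-invariant smooth)` = `Δ · (F ∘ esymm)` by ★ Glaeser-`S₃` `exists_contDiff_comp_esymm_three_of_forall_perm`».  Author F0P3a-p04 (g27).  Count-neutral.

THE MATHEMATICS (all with a finite-dimensional parameter space `P` and values in a complete normed space `G`).  The division itself — «an `S₃`-ALTERNATING `C^∞` function is `Δ •` a
SYMMETRIC `C^∞` function» — is ★ `exists_contDiff_symm_vandermonde_smul_of_alternating` (`AlternatingDivisionThree`, LH10-p02 (g9), same hour); this file adds what the corner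
consumers asked for around it (ref5 R-736 (c): the GERM form; (12′)∕(11): the composed Glaeser form) plus two generic tools.
* §1 **Hadamard division by a linear functional** `exists_contDiff_eq_smul_of_forall_eq_zero`: on a finite-dimensional `V`, if `f ∈ C^∞(V, G)` vanishes on the hyperplane `ℓ = 0`
  (`ℓ : V →L[ℝ] ℝ`, `ℓ e = 1` for some `e`), then `f = ℓ • g` with `g ∈ C^∞` — ★ `lastQuot` transported along the linear surjection `(u, t) ↦ u − ℓ(u)e + te` (any hyperplane, not
  only the root walls of ★ `exists_contDiff_sub_smul_of_wall`).
* §2 density bookkeeping: the points of `(Fin 3 → ℝ) × P` with pairwise distinct coordinates are DENSE (`dense_setOf_injective`: move along `t ↦ x + t·(0,1,2)`), so two continuous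
  functions that agree off the three walls agree (`eq_of_eqOn_setOf_injective`); an anti-invariant function vanishes on its wall (`eq_zero_of_apply_comp_swap_eq_neg`); the
  Vandermonde product is non-zero at a regular point (`vandermonde₃_ne_zero_of_injective`).
* §3 `apply_comp_perm_eq_sign_smul_of_forall_swap` (anti-invariance under the three transpositions ⇒ the alternating letter `f (x ∘ σ) = sign σ • f x` of ★), the head in
  TRANSPOSITION form **`exists_contDiff_eq_vandermonde_smul_of_forall_swap`** (= ★ read through it), and UNIQUENESS of the quotient `eq_of_vandermonde_smul_eq` (§2).
HONEST LABEL: calculus plumbing; HC_CM is proved only modulo the 7 printed citations (2 remaining: hLiu418 = stmt-HodgeConjecture-24832, h413 = stmt-HodgeConjecture-24833) until rung 0 closes.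

## References
* [HormanderALPDO1] L. Hörmander, *The Analysis of Linear Partial Differential Operators I*, 2nd ed. (1990), Thm. 1.1.9 (Hadamard's lemma ∕ Taylor with smooth remainder).
* [Bourbaki2008LieGroups79] N. Bourbaki, *Lie Groups and Lie Algebras, Chapters 7–9* (Springer 2008), Ch. VIII §8 no. 3–4 (anti-invariant polynomials ∕ functions are divisible by the product of the positive roots).
* [Milnor1963] J. Milnor, *Morse Theory* (1963), Lemma 2.1 (Hadamard's lemma).
-/

set_option autoImplicit false

noncomputable section

open Set Function Filter Topology
open scoped ContDiff

namespace Literature.Analysis.Calculus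

variable {P : Type*} [NormedAddCommGroup P] [NormedSpace ℝ P] [FiniteDimensional ℝ P]
variable {G : Type*} [NormedAddCommGroup G] [NormedSpace ℝ G] [CompleteSpace G]

/-! ## §1 Hadamard division by a linear functional -/

section Division

variable {V : Type*} [NormedAddCommGroup V] [NormedSpace ℝ V] [FiniteDimensional ℝ V]

/-- **HADAMARD DIVISION BY A LINEAR FUNCTIONAL**: if `f ∈ C^∞(V, G)` vanishes on the hyperplane `{ℓ = 0}` of the finite-dimensional space `V` (`ℓ e = 1`), then `f = ℓ • g` with
`g ∈ C^∞(V, G)` — ★ `eq_smul_lastQuot` ∕ `contDiff_lastQuot` for `g′(u, t) := f (u − ℓ(u)e + te)` on `V × ℝ`, read back along `v ↦ (v − ℓ(v)e, ℓ v)`. [cite: HormanderALPDO1, Thm. 1.1.9]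
[cite: Milnor1963, Lemma 2.1] -/
theorem exists_contDiff_eq_smul_of_forall_eq_zero (ℓ : V →L[ℝ] ℝ) {e : V} (he : ℓ e = 1) (f : V → G) (hf : ContDiff ℝ ∞ f) (h0 : ∀ v, ℓ v = 0 → f v = 0) :
    ∃ g : V → G, ContDiff ℝ ∞ g ∧ ∀ v, f v = ℓ v • g v := by
  -- the surjection `B (u, t) = u − ℓ(u) e + t e` and its section `A v = (v − ℓ(v) e, ℓ v)`
  have hB : ContDiff ℝ ∞ fun q : V × ℝ => q.1 - ℓ q.1 • e + q.2 • e :=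
    (contDiff_fst.sub ((ℓ.contDiff.comp contDiff_fst).smul contDiff_const)).add (contDiff_snd.smul contDiff_const)
  have hA : ContDiff ℝ ∞ fun v : V => ((v - ℓ v • e, ℓ v) : V × ℝ) := (contDiff_id.sub (ℓ.contDiff.smul contDiff_const)).prodMk ℓ.contDiff
  set g' : V × ℝ → G := fun q => f (q.1 - ℓ q.1 • e + q.2 • e) with hg'
  have hg's : ContDiff ℝ ∞ g' := hf.comp hB
  have hg'0 : ∀ u : V, g' (u, 0) = 0 := fun u => by
    simp only [hg', zero_smul, add_zero]
    exact h0 _ (by rw [map_sub, map_smul, he, smul_eq_mul, mul_one, sub_self])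
  have hg'1 : ContDiff ℝ 1 g' := hg's.of_le (by exact_mod_cast le_top)
  have hq : ContDiff ℝ ∞ (lastQuot g') := by
    have h : ContDiff ℝ (((⊤ : ℕ∞) + 1 : ℕ∞) : WithTop ℕ∞) g' := by simpa using hg's
    exact contDiff_lastQuot h
  refine ⟨fun v => lastQuot g' (v - ℓ v • e, ℓ v), hq.comp hA, fun v => ?_⟩
  have hv : f v = g' (v - ℓ v • e, ℓ v) := by
    simp only [hg', map_sub, map_smul, he, smul_eq_mul, mul_one, sub_self, zero_smul, sub_zero]
    rw [sub_add_cancel]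
  rw [hv]
  exact eq_smul_lastQuot hg'1 hg'0 _

end Division

/-! ## §2 Density of the regular set and vanishing on the walls -/

section Density

/-- Three pairwise inequalities give injectivity on `Fin 3`. [folklore] -/
private theorem injective_of_ne₃ {x : Fin 3 → ℝ} (h01 : x 0 ≠ x 1) (h02 : x 0 ≠ x 2) (h12 : x 1 ≠ x 2) : Function.Injective x := by
  intro a b hab
  fin_cases a <;> fin_cases b
  all_goals first
    | rfl
    | exact absurd hab h01
    | exact absurd hab.symm h01
    | exact absurd hab h02
    | exact absurd hab.symm h02
    | exact absurd hab h12
    | exact absurd hab.symm h12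

/-- `a + c·t_n ≠ 0` eventually along `t_n = 1∕(n+1) → 0`, for `c ≠ 0` (if `a = 0` every term is non-zero; otherwise the limit `a` is). [folklore] -/
private theorem eventually_add_mul_one_div_ne_zero (a c : ℝ) (hc : c ≠ 0) : ∀ᶠ n : ℕ in atTop, a + c * (1 / ((n : ℝ) + 1)) ≠ 0 := by
  by_cases ha : a = 0
  · refine Filter.Eventually.of_forall fun n => ?_
    rw [ha, zero_add]
    exact mul_ne_zero hc (one_div_ne_zero (by positivity))
  · have ht : Tendsto (fun n : ℕ => a + c * (1 / ((n : ℝ) + 1))) atTop (𝓝 a) := by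
      have h := (tendsto_one_div_add_atTop_nhds_zero_nat).const_mul c
      simpa using h.const_add a
    exact ht.eventually_ne ha

omit [NormedSpace ℝ P] [FiniteDimensional ℝ P] in
/-- **THE REGULAR SET IS DENSE**: in `(Fin 3 → ℝ) × P` the points with pairwise distinct first coordinates are dense (approach `(x, p)` along `x + t·(0, 1, 2)`, `t = 1∕(n+1)`).
[cite: Bourbaki2008LieGroups79, Ch. VIII §8 no. 3] -/
theorem dense_setOf_injective : Dense {v : (Fin 3 → ℝ) × P | Function.Injective v.1} := by
  intro v
  -- the approximating sequence
  set c : Fin 3 → ℝ := ![0, 1, 2] with hc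
  have hseq : Tendsto (fun n : ℕ => ((v.1 + (1 / ((n : ℝ) + 1)) • c, v.2) : (Fin 3 → ℝ) × P)) atTop (𝓝 v) := by
    have h1 : Tendsto (fun n : ℕ => v.1 + (1 / ((n : ℝ) + 1)) • c) atTop (𝓝 v.1) := by
      have h := ((tendsto_one_div_add_atTop_nhds_zero_nat (𝕜 := ℝ)).smul_const c).const_add v.1
      rwa [zero_smul, add_zero] at h
    exact h1.prodMk_nhds tendsto_const_nhds
  refine mem_closure_of_tendsto hseq ?_
  -- eventually all three differences are non-zero
  have hval : ∀ (n : ℕ) (k : Fin 3), (v.1 + (1 / ((n : ℝ) + 1)) • c) k = v.1 k + c k * (1 / ((n : ℝ) + 1)) := fun n k => by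
    simp only [Pi.add_apply, Pi.smul_apply, smul_eq_mul]; ring
  have hdiff : ∀ (a b : Fin 3), c a ≠ c b → ∀ᶠ n : ℕ in atTop, (v.1 + (1 / ((n : ℝ) + 1)) • c) a ≠ (v.1 + (1 / ((n : ℝ) + 1)) • c) b := by
    intro a b hab
    filter_upwards [eventually_add_mul_one_div_ne_zero (v.1 a - v.1 b) (c a - c b) (sub_ne_zero.2 hab)] with n hn
    intro h
    apply hn
    rw [hval, hval] at h
    linear_combination h
  have c01 : c 0 ≠ c 1 := by simp [hc]
  have c02 : c 0 ≠ c 2 := by simp [hc]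
  have c12 : c 1 ≠ c 2 := by simp [hc]
  filter_upwards [hdiff 0 1 c01, hdiff 0 2 c02, hdiff 1 2 c12] with n h01 h02 h12
  exact injective_of_ne₃ h01 h02 h12

omit [NormedSpace ℝ P] [FiniteDimensional ℝ P] in
/-- **Two continuous functions that agree at the points with pairwise distinct coordinates agree everywhere.** [cite: Bourbaki2008LieGroups79, Ch. VIII §8 no. 3] -/
theorem eq_of_eqOn_setOf_injective {X : Type*} [TopologicalSpace X] [T2Space X] {φ ψ : (Fin 3 → ℝ) × P → X} (hφ : Continuous φ) (hψ : Continuous ψ)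
    (h : ∀ (x : Fin 3 → ℝ) (p : P), Function.Injective x → φ (x, p) = ψ (x, p)) : φ = ψ :=
  Continuous.ext_on dense_setOf_injective hφ hψ fun v hv => h v.1 v.2 hv

/-- On the wall `{x_i = x_j}` the transposition `(i j)` acts trivially on `x`. [folklore] -/
private theorem comp_swap_eq_self_of_eq {x : Fin 3 → ℝ} {i j : Fin 3} (h : x i = x j) : x ∘ Equiv.swap i j = x := by
  funext k
  simp only [Function.comp_apply]
  by_cases hki : k = i
  · subst hki; rw [Equiv.swap_apply_left, h]
  · by_cases hkj : k = j
    · subst hkj; rw [Equiv.swap_apply_right, h]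
    · rw [Equiv.swap_apply_of_ne_of_ne hki hkj]

omit [NormedAddCommGroup P] [NormedSpace ℝ P] [FiniteDimensional ℝ P] [CompleteSpace G] in
/-- **An ANTI-invariant function vanishes on its wall**: `f (x ∘ (i j), p) = −f (x, p)` and `x_i = x_j` give `f (x, p) = 0`. [cite: Bourbaki2008LieGroups79, Ch. VIII §8 no. 3] -/
theorem eq_zero_of_apply_comp_swap_eq_neg {f : (Fin 3 → ℝ) × P → G} {i j : Fin 3} (hanti : ∀ (x : Fin 3 → ℝ) (p : P), f (x ∘ Equiv.swap i j, p) = -f (x, p))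
    {x : Fin 3 → ℝ} (p : P) (h : x i = x j) : f (x, p) = 0 := by
  have h1 := hanti x p
  rw [comp_swap_eq_self_of_eq h] at h1
  -- `f = −f` in a real vector space
  have h2 : (2 : ℝ) • f (x, p) = 0 := by rw [two_smul]; nth_rewrite 1 [h1]; exact neg_add_cancel _
  exact (smul_eq_zero.1 h2).resolve_left two_ne_zero

/-- The Vandermonde product is non-zero at a point with pairwise distinct coordinates. [cite: Bourbaki2008LieGroups79, Ch. VIII §8 no. 3] -/
theorem vandermonde₃_ne_zero_of_injective {x : Fin 3 → ℝ} (hx : Function.Injective x) : (x 0 - x 1) * (x 0 - x 2) * (x 1 - x 2) ≠ 0 :=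
  mul_ne_zero (mul_ne_zero (sub_ne_zero.2 fun h => absurd (hx h) (by decide)) (sub_ne_zero.2 fun h => absurd (hx h) (by decide)))
    (sub_ne_zero.2 fun h => absurd (hx h) (by decide))

end Density

/-! ## §3 From transposition anti-invariance to the alternating letter, and the head -/

section Head

omit [NormedAddCommGroup P] [NormedSpace ℝ P] [FiniteDimensional ℝ P] [CompleteSpace G] in
/-- **TRANSPOSITION ANTI-INVARIANCE ⇒ ALTERNATING UNDER ALL OF `S₃`**: if `f (x ∘ (i j), p) = −f (x, p)` for the three transpositions then `f (x ∘ σ, p) = sign σ • f (x, p)` for every `σ`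
(induction over transpositions, Mathlib `Equiv.Perm.swap_induction_on'`) — the letter ★ `exists_contDiff_symm_vandermonde_smul_of_alternating` consumes. [cite: Bourbaki2008LieGroups79, Ch. VIII §8 no. 3] -/
theorem apply_comp_perm_eq_sign_smul_of_forall_swap {f : (Fin 3 → ℝ) × P → G}
    (hanti : ∀ (i j : Fin 3), i ≠ j → ∀ (x : Fin 3 → ℝ) (p : P), f (x ∘ Equiv.swap i j, p) = -f (x, p)) (σ : Equiv.Perm (Fin 3)) (x : Fin 3 → ℝ) (p : P) :
    f (x ∘ σ, p) = ((Equiv.Perm.sign σ : ℤ) : ℝ) • f (x, p) := by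
  induction σ using Equiv.Perm.swap_induction_on' generalizing x with
  | one => simp
  | mul_swap τ a b hab ih =>
    have hcomp : (x ∘ ⇑(τ * Equiv.swap a b)) = ((x ∘ ⇑τ) ∘ ⇑(Equiv.swap a b)) := by funext k; simp
    rw [hcomp, hanti a b hab, ih, Equiv.Perm.sign_mul, Equiv.Perm.sign_swap hab]
    push_cast
    rw [mul_neg_one, neg_smul]

/-- **«HADAMARD ×3» IN TRANSPOSITION FORM — A SMOOTH FUNCTION ANTI-INVARIANT UNDER THE THREE TRANSPOSITIONS IS THE VANDERMONDE PRODUCT TIMES A SMOOTH `S₃`-INVARIANT FUNCTION.**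
For `f ∈ C^∞((Fin 3 → ℝ) × P, G)` with `f (x ∘ (i j), p) = −f (x, p)`: `f (x, p) = (x₀−x₁)(x₀−x₂)(x₁−x₂) • h (x, p)` with `h ∈ C^∞` and `h (x ∘ σ, p) = h (x, p)` for every `σ ∈ S₃` — ★
`exists_contDiff_symm_vandermonde_smul_of_alternating` (LH10-p02 (g9): divide by the three root factors, symmetrise the quotient) read through `apply_comp_perm_eq_sign_smul_of_forall_swap`.
With ★ Glaeser-`S₃` this gives `f = Δ · (F ∘ (esymm, id))` (§4). [cite: Bourbaki2008LieGroups79, Ch. VIII §8 no. 3–4] [cite: HormanderALPDO1, Thm. 1.1.9] -/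
theorem exists_contDiff_eq_vandermonde_smul_of_forall_swap (f : (Fin 3 → ℝ) × P → G) (hf : ContDiff ℝ ∞ f)
    (hanti : ∀ (i j : Fin 3), i ≠ j → ∀ (x : Fin 3 → ℝ) (p : P), f (x ∘ Equiv.swap i j, p) = -f (x, p)) :
    ∃ h : (Fin 3 → ℝ) × P → G, ContDiff ℝ ∞ h ∧ (∀ (x : Fin 3 → ℝ) (p : P), f (x, p) = ((x 0 - x 1) * (x 0 - x 2) * (x 1 - x 2)) • h (x, p)) ∧
      ∀ (σ : Equiv.Perm (Fin 3)) (x : Fin 3 → ℝ) (p : P), h (x ∘ σ, p) = h (x, p) := by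
  obtain ⟨V, hV, hVσ, hfV⟩ := exists_contDiff_symm_vandermonde_smul_of_alternating f hf (apply_comp_perm_eq_sign_smul_of_forall_swap hanti)
  exact ⟨V, hV, hfV, hVσ⟩

omit [NormedSpace ℝ P] [FiniteDimensional ℝ P] [CompleteSpace G] in
/-- **UNIQUENESS OF THE QUOTIENT**: two continuous functions `h, h′` with `Δ • h = Δ • h′` agree everywhere (cancel off the walls, `vandermonde₃_ne_zero_of_injective`; density
`eq_of_eqOn_setOf_injective`).  So the symmetric quotient of ★ does not depend on the order of the three divisions. [cite: Bourbaki2008LieGroups79, Ch. VIII §8 no. 3] -/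
theorem eq_of_vandermonde_smul_eq {h h' : (Fin 3 → ℝ) × P → G} (hh : Continuous h) (hh' : Continuous h')
    (heq : ∀ (x : Fin 3 → ℝ) (p : P), ((x 0 - x 1) * (x 0 - x 2) * (x 1 - x 2)) • h (x, p) = ((x 0 - x 1) * (x 0 - x 2) * (x 1 - x 2)) • h' (x, p)) : h = h' :=
  eq_of_eqOn_setOf_injective hh hh' fun x p hx => smul_right_injective G (vandermonde₃_ne_zero_of_injective hx) (heq x p)

end Head

/-! ## §4 Corollaries: the germ form at a diagonal point, and the composition with Glaeser–Chevalley -/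

section Corollaries

/-- **GERM FORM AT A DIAGONAL POINT** (the shape corner constructions consume): a function smooth on a sup-ball about `(t, t, t)` (such balls are permutation stable) and ANTI-invariant
there is, on the half ball, `Δ • h` with `h` GLOBALLY smooth and `S₃`-invariant — multiply by the symmetric product cut-off ★ `exists_contDiff_prod_cutoff` (the product is globally smooth,
★ `contDiff_smul_fst_of_tsupport_subset`, and globally anti-invariant) and apply the global head. [cite: Bourbaki2008LieGroups79, Ch. VIII §8 no. 3] [cite: HormanderALPDO1, Thm. 1.1.9] -/
theorem exists_contDiff_eq_vandermonde_smul_of_forall_swap_ball (f : (Fin 3 → ℝ) × P → G) (t : ℝ) {r : ℝ} (hr : 0 < r)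
    (hf : ContDiffOn ℝ ∞ f (Metric.ball (fun _ => t) r ×ˢ Set.univ))
    (hanti : ∀ (i j : Fin 3), i ≠ j → ∀ x ∈ Metric.ball (fun _ : Fin 3 => t) r, ∀ p : P, f (x ∘ Equiv.swap i j, p) = -f (x, p)) :
    ∃ h : (Fin 3 → ℝ) × P → G, ContDiff ℝ ∞ h ∧ (∀ (σ : Equiv.Perm (Fin 3)) (x : Fin 3 → ℝ) (p : P), h (x ∘ σ, p) = h (x, p)) ∧
      ∀ x ∈ Metric.ball (fun _ : Fin 3 => t) (r / 2), ∀ p : P, f (x, p) = ((x 0 - x 1) * (x 0 - x 2) * (x 1 - x 2)) • h (x, p) := by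
  have hr2 : 0 < r / 2 := half_pos hr
  obtain ⟨χ, hχ, hχ1, hχU, hχσ⟩ := exists_contDiff_prod_cutoff 3 t hr2 (half_lt_self hr)
  -- the cut-off product, extended by zero: globally smooth and globally anti-invariant
  set F : (Fin 3 → ℝ) × P → G := fun q => χ q.1 • f q with hF
  have hFc : ContDiff ℝ ∞ F := contDiff_smul_fst_of_tsupport_subset Metric.isOpen_ball hχ hχU hf
  have hFanti : ∀ (i j : Fin 3), i ≠ j → ∀ (x : Fin 3 → ℝ) (p : P), F (x ∘ Equiv.swap i j, p) = -F (x, p) := by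
    intro i j hij x p
    simp only [hF, hχσ (Equiv.swap i j) x]
    by_cases hx : x ∈ Metric.ball (fun _ : Fin 3 => t) r
    · rw [hanti i j hij x hx p, smul_neg]
    · have hx0 : χ x = 0 := by
        by_contra h
        exact hx (hχU (subset_tsupport _ (mem_support.2 h)))
      rw [hx0, zero_smul, zero_smul, neg_zero]
  obtain ⟨h, hh, hFh, hσ⟩ := exists_contDiff_eq_vandermonde_smul_of_forall_swap F hFc hFanti
  refine ⟨h, hh, hσ, fun x hx p => ?_⟩
  rw [← hFh x p, hF]
  simp only [hχ1 x hx, one_smul]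

end Corollaries

section Glaeser

universe u

variable {P' : Type u} [NormedAddCommGroup P'] [NormedSpace ℝ P'] [FiniteDimensional ℝ P']
variable {E' : Type u} [NormedAddCommGroup E'] [NormedSpace ℝ E'] [CompleteSpace E']

/-- **ANTI-INVARIANT = VANDERMONDE × (SMOOTH FUNCTION OF THE ELEMENTARY SYMMETRIC FUNCTIONS)** — the head composed with ★ Glaeser–Chevalley for `S₃`
(`exists_contDiff_comp_esymm_three_of_forall_perm`; parameter and value spaces in one universe, as ★ pins them): `f (x, p) = Δ(x) • g ((e₁, e₂, e₃)(x), p)` with `g` smooth.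
[cite: Bourbaki2008LieGroups79, Ch. VIII §8 no. 3–4] [cite: HormanderALPDO1, Thm. 1.1.9] -/
theorem exists_contDiff_eq_vandermonde_smul_comp_esymm_of_forall_swap (f : (Fin 3 → ℝ) × P' → E') (hf : ContDiff ℝ ∞ f)
    (hanti : ∀ (i j : Fin 3), i ≠ j → ∀ (x : Fin 3 → ℝ) (p : P'), f (x ∘ Equiv.swap i j, p) = -f (x, p)) :
    ∃ g : (Fin 3 → ℝ) × P' → E', ContDiff ℝ ∞ g ∧
      ∀ (x : Fin 3 → ℝ) (p : P'), f (x, p) = ((x 0 - x 1) * (x 0 - x 2) * (x 1 - x 2)) • g (![x 0 + x 1 + x 2, x 0 * x 1 + x 0 * x 2 + x 1 * x 2, x 0 * x 1 * x 2], p) := by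
  obtain ⟨h, hh, hfh, hσ⟩ := exists_contDiff_eq_vandermonde_smul_of_forall_swap f hf hanti
  obtain ⟨g, hg, hhg⟩ := exists_contDiff_comp_esymm_three_of_forall_perm h hh hσ
  exact ⟨g, hg, fun x p => by rw [hfh, hhg]⟩

end Glaeser

end Literature.Analysis.Calculus

end
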